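import Summits.Ventures.HSemireg.Mod4SiteSigns

/-!
# Venture HSemireg — MOD-4 line: the rows `Σ₁[B,B′] = κ·(−1)^{|B′|}·q_{n−|B|+|B′|}` of THEOREM R_f's middle-degree block
# (the three-line expansion on top of the SIGN LEMMA, for every `n` and arbitrary letters)

HONEST FRAMING. Part of the Lean index of the computation cell `pub-hsemireg` (widening group W3, seat w3-mod4-1 gen 5; files
of record `HOME/widen/W3/MOD4-OFFSPLIT-w3mod4.md` §10.2 / §11, `MOD4-THEOREM-RF-PROOF-w3mod4.md` v1.0 §4).  EXTERIOR ALGEBRA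
OVER A COMMUTATIVE RING ONLY: no abelian variety, no sheaf, no Ext group, no semiregularity map; nothing here says that HC,
HC_CM or HC_AV holds; no Literature fact is declared or used; THEOREM R_f is NOT asserted here.  Sequel of `Mod4SiteSigns.lean`
(gate p359944): there `word_mul_eta` proved `μ_B·η^P_p = [p = n − |B|]·κ·m_P`, `κ = (−1)^{C(n+1,2)}`, for the words on ONE block
of `n` sites.  The proof sheet §4 continues (two blocks `P`, `Q` of `n` sites each; `Π(λ) = Π_P(λ)·Π_Q(λ)`, so the
`λ^i`-coefficient is `η̃_i = Σ_p η^P_p·η^Q_{i−p}`): «Hence `μ_B·(Σ_i q_iη̃_i) = κ Σ_j q_{j+n−m} m_P η^Q_j =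
κ Σ_{B′⊂Q} (−1)^{|B′|} q_{n−|B|+|B′|} f_{B′}`, `f_{B′} := m_P μ′_{B′}`», i.e. the row `Σ₁[B,·]` of the block matrix
`[[α·1, Σ₁],[Σ₂, β·1]]`.  THIS FILE KERNEL-CHECKS THAT EXPANSION for every `n`, ANY letters `x_i, y_i` (block `P`) and `x′_j, y′_j`
(block `Q`) of any module over any commutative ring, and ANY coefficient sequence `q : ℕ → R`:
* `wordP_mul_etaTilde` — `μ_B·η̃_i = [n − |B| ≤ i]·κ·(m_P·η^Q_{i−(n−|B|)})` with `η̃_i := Σ_{p ≤ i} η^P_p·η^Q_{i−p}`;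
* `sum_smul_etaQ_eq_sum_powerset` — regrouping `Σ_{j ≤ n} c_j·η^Q_j = Σ_{B′ ⊆ Q} ((−1)^{|B′|} c_{|B′|})·μ′_{B′}`;
* `wordP_mul_classSum` — **`μ_B·(Σ_{i ≤ 2n} q_i·η̃_i) = κ · Σ_{B′ ⊆ Q} ((−1)^{|B′|}·q_{n−|B|+|B′|})·(m_P·μ′_{B′})`** (the `Σ₁` row;
  the mirror row `Σ₂` is the same computation with the blocks exchanged, times the commutation sign `(−1)^{n·n} = (−1)ⁿ` of
  `Mod4Site.prod_ofFn_mul_comm_self`).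
No definitions are introduced (words, `η`, `η̃` are carried verbatim as `List.ofFn`-products and finite sums).
All statements and proofs: w3-mod4-1 g5 (2026-08-23).  Namespace `Summit.Ventures.HSemireg.Mod4Site`.
-/

namespace Summit.Ventures.HSemireg.Mod4Site

open ExteriorAlgebra

variable {R : Type*} [CommRing R] {M : Type*} [AddCommGroup M] [Module R M] {n : ℕ}
variable (x y x' y' : Fin n → M)

/-- **`μ_B·η̃_i`**: with `η̃_i := Σ_{p ∈ [0,i]} η^P_p·η^Q_{i−p}` (the `λ^i`-coefficient of `Π_P(λ)·Π_Q(λ)`), only `p = n − |B|`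
survives: `μ_B·η̃_i = [n − |B| ≤ i]·(−1)^{C(n+1,2)}·(m_P·η^Q_{i−(n−|B|)})`. -/
theorem wordP_mul_etaTilde (B : Finset (Fin n)) (i : ℕ) :
    (List.ofFn fun k => ι R (if k ∈ B then y k else x k)).prod *
        (∑ p ∈ Finset.range (i + 1),
          (((-1 : R) ^ p) • ∑ T ∈ (Finset.univ : Finset (Fin n)).powersetCard p,
              (List.ofFn fun k => ι R (if k ∈ T then y k else x k)).prod) *
          (((-1 : R) ^ (i - p)) • ∑ T' ∈ (Finset.univ : Finset (Fin n)).powersetCard (i - p),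
              (List.ofFn fun k => ι R (if k ∈ T' then y' k else x' k)).prod)) =
      if n - B.card ≤ i then
        ((-1 : R) ^ (n + 1).choose 2) • ((List.ofFn fun k => ι R (x k) * ι R (y k)).prod *
          (((-1 : R) ^ (i - (n - B.card))) • ∑ T' ∈ (Finset.univ : Finset (Fin n)).powersetCard (i - (n - B.card)),
              (List.ofFn fun k => ι R (if k ∈ T' then y' k else x' k)).prod))
      else 0 := by
  rw [Finset.mul_sum]
  have step : ∀ p ∈ Finset.range (i + 1),
      (List.ofFn fun k => ι R (if k ∈ B then y k else x k)).prod *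
        ((((-1 : R) ^ p) • ∑ T ∈ (Finset.univ : Finset (Fin n)).powersetCard p,
              (List.ofFn fun k => ι R (if k ∈ T then y k else x k)).prod) *
          (((-1 : R) ^ (i - p)) • ∑ T' ∈ (Finset.univ : Finset (Fin n)).powersetCard (i - p),
              (List.ofFn fun k => ι R (if k ∈ T' then y' k else x' k)).prod)) =
      if p = n - B.card then
        ((-1 : R) ^ (n + 1).choose 2) • ((List.ofFn fun k => ι R (x k) * ι R (y k)).prod *
          (((-1 : R) ^ (i - (n - B.card))) • ∑ T' ∈ (Finset.univ : Finset (Fin n)).powersetCard (i - (n - B.card)),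
              (List.ofFn fun k => ι R (if k ∈ T' then y' k else x' k)).prod))
      else 0 := by
    intro p _
    rw [← mul_assoc, word_mul_eta x y B p]
    split_ifs with hp
    · rw [hp, smul_mul_assoc]
    · rw [zero_mul]
  rw [Finset.sum_congr rfl step, Finset.sum_ite_eq' (Finset.range (i + 1)) (n - B.card)]
  by_cases h : n - B.card ≤ i
  · rw [if_pos (Finset.mem_range.mpr (Nat.lt_succ_of_le h)), if_pos h]
  · rw [if_neg (fun h' => h (Nat.le_of_lt_succ (Finset.mem_range.mp h'))), if_neg h]

/-- regrouping a size-graded sum of the `η^Q_j` over all subsets: `Σ_{j ≤ n} c_j·η^Q_j = Σ_{B′ ⊆ Q} ((−1)^{|B′|} c_{|B′|})·μ′_{B′}`. -/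
theorem sum_smul_etaQ_eq_sum_powerset (c : ℕ → R) :
    ∑ j ∈ Finset.range (n + 1), c j • (((-1 : R) ^ j) • ∑ T' ∈ (Finset.univ : Finset (Fin n)).powersetCard j,
        (List.ofFn fun k => ι R (if k ∈ T' then y' k else x' k)).prod) =
      ∑ B' ∈ (Finset.univ : Finset (Fin n)).powerset,
        (((-1 : R) ^ B'.card) * c B'.card) • (List.ofFn fun k => ι R (if k ∈ B' then y' k else x' k)).prod := by
  rw [Finset.powerset_card_disjiUnion, Finset.sum_disjiUnion, Finset.card_univ, Fintype.card_fin]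
  refine Finset.sum_congr rfl fun j _ => ?_
  rw [smul_smul, Finset.smul_sum]
  refine Finset.sum_congr rfl fun B' hB' => ?_
  rw [(Finset.mem_powersetCard.mp hB').2, mul_comm]

/-- reindexing: `Σ_{i ≤ 2n} [n−m ≤ i]·q_i·g(i − (n−m)) = Σ_{j ≤ n+m} q_{j+(n−m)}·g(j)` for `m ≤ n`. -/
lemma sum_shift {A : Type*} [AddCommMonoid A] [Module R A] (q : ℕ → R) (g : ℕ → A) {m : ℕ} (hm : m ≤ n) :
    ∑ i ∈ Finset.range (n + n + 1), (if n - m ≤ i then q i • g (i - (n - m)) else 0) =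
      ∑ j ∈ Finset.range (n + m + 1), q (j + (n - m)) • g j := by
  rw [← Finset.sum_filter]
  refine Finset.sum_nbij' (fun i => i - (n - m)) (fun j => j + (n - m)) ?_ ?_ ?_ ?_ ?_
  · intro i hi
    rw [Finset.mem_filter, Finset.mem_range] at hi
    rw [Finset.mem_range]; omega
  · intro j hj
    rw [Finset.mem_range] at hj
    rw [Finset.mem_filter, Finset.mem_range]; omega
  · intro i hi
    rw [Finset.mem_filter, Finset.mem_range] at hi
    show i - (n - m) + (n - m) = i; omega
  · intro j _
    show j + (n - m) - (n - m) = j; omega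
  · intro i hi
    rw [Finset.mem_filter, Finset.mem_range] at hi
    rw [show i - (n - m) + (n - m) = i by omega]

/-- the `η^Q_j` vanish beyond `j = n` (no subsets of that size), so a sum up to `n + m` truncates to `n`. -/
lemma sum_etaQ_truncate {m : ℕ} (c : ℕ → R) :
    ∑ j ∈ Finset.range (n + m + 1), c j • (((-1 : R) ^ j) • ∑ T' ∈ (Finset.univ : Finset (Fin n)).powersetCard j,
        (List.ofFn fun k => ι R (if k ∈ T' then y' k else x' k)).prod) =
      ∑ j ∈ Finset.range (n + 1), c j • (((-1 : R) ^ j) • ∑ T' ∈ (Finset.univ : Finset (Fin n)).powersetCard j,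
        (List.ofFn fun k => ι R (if k ∈ T' then y' k else x' k)).prod) := by
  symm
  refine Finset.sum_subset (Finset.range_subset_range.mpr (by omega)) fun j hj hj' => ?_
  rw [Finset.mem_range] at hj hj'
  rw [Finset.powersetCard_eq_empty.mpr (by rw [Finset.card_univ, Fintype.card_fin]; omega), Finset.sum_empty,
    smul_zero, smul_zero]

/-- **THE `Σ₁` ROW** (proof sheet §4): for every `B ⊆ P` (`|B| = m`) and every coefficient sequence `q`,
`μ_B · (Σ_{i ≤ 2n} q_i·η̃_i) = κ · Σ_{B′ ⊆ Q} ((−1)^{|B′|}·q_{n−m+|B′|}) · (m_P · μ′_{B′})`, `κ = (−1)^{C(n+1,2)}` —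
the h-part `Σ_i q_iη̃_i` multiplied by a `P`-word lands in the span of the `Q`-side tags `f_{B′} = m_P·μ′_{B′}` with the
coefficients `Σ₁[B,B′] = κ(−1)^{|B′|}q_{n−|B|+|B′|}`, which depend on `B`, `B′` only through their sizes. -/
theorem wordP_mul_classSum (B : Finset (Fin n)) (q : ℕ → R) :
    (List.ofFn fun k => ι R (if k ∈ B then y k else x k)).prod *
        (∑ i ∈ Finset.range (n + n + 1), q i • ∑ p ∈ Finset.range (i + 1),
          (((-1 : R) ^ p) • ∑ T ∈ (Finset.univ : Finset (Fin n)).powersetCard p,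
              (List.ofFn fun k => ι R (if k ∈ T then y k else x k)).prod) *
          (((-1 : R) ^ (i - p)) • ∑ T' ∈ (Finset.univ : Finset (Fin n)).powersetCard (i - p),
              (List.ofFn fun k => ι R (if k ∈ T' then y' k else x' k)).prod)) =
      ((-1 : R) ^ (n + 1).choose 2) • ∑ B' ∈ (Finset.univ : Finset (Fin n)).powerset,
        (((-1 : R) ^ B'.card) * q (n - B.card + B'.card)) •
          ((List.ofFn fun k => ι R (x k) * ι R (y k)).prod * (List.ofFn fun k => ι R (if k ∈ B' then y' k else x' k)).prod) := by
  have hBn : B.card ≤ n := by simpa using Finset.card_le_univ B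
  rw [Finset.mul_sum]
  have step : ∀ i ∈ Finset.range (n + n + 1),
      (List.ofFn fun k => ι R (if k ∈ B then y k else x k)).prod *
        (q i • ∑ p ∈ Finset.range (i + 1),
          (((-1 : R) ^ p) • ∑ T ∈ (Finset.univ : Finset (Fin n)).powersetCard p,
              (List.ofFn fun k => ι R (if k ∈ T then y k else x k)).prod) *
          (((-1 : R) ^ (i - p)) • ∑ T' ∈ (Finset.univ : Finset (Fin n)).powersetCard (i - p),
              (List.ofFn fun k => ι R (if k ∈ T' then y' k else x' k)).prod)) =
      if n - B.card ≤ i then q i • (((-1 : R) ^ (n + 1).choose 2) • ((List.ofFn fun k => ι R (x k) * ι R (y k)).prod *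
          (((-1 : R) ^ (i - (n - B.card))) • ∑ T' ∈ (Finset.univ : Finset (Fin n)).powersetCard (i - (n - B.card)),
              (List.ofFn fun k => ι R (if k ∈ T' then y' k else x' k)).prod))) else 0 := by
    intro i _
    rw [mul_smul_comm, wordP_mul_etaTilde]
    split_ifs <;> simp
  rw [Finset.sum_congr rfl step]
  rw [sum_shift (R := R) (A := ExteriorAlgebra R M) q (fun j => ((-1 : R) ^ (n + 1).choose 2) •
      ((List.ofFn fun k => ι R (x k) * ι R (y k)).prod *
        (((-1 : R) ^ j) • ∑ T' ∈ (Finset.univ : Finset (Fin n)).powersetCard j,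
          (List.ofFn fun k => ι R (if k ∈ T' then y' k else x' k)).prod))) hBn]
  have hterm : ∀ j ∈ Finset.range (n + B.card + 1),
      q (j + (n - B.card)) • (((-1 : R) ^ (n + 1).choose 2) • ((List.ofFn fun k => ι R (x k) * ι R (y k)).prod *
        (((-1 : R) ^ j) • ∑ T' ∈ (Finset.univ : Finset (Fin n)).powersetCard j,
          (List.ofFn fun k => ι R (if k ∈ T' then y' k else x' k)).prod))) =
      ((-1 : R) ^ (n + 1).choose 2) • ((List.ofFn fun k => ι R (x k) * ι R (y k)).prod *
        (q (j + (n - B.card)) • (((-1 : R) ^ j) • ∑ T' ∈ (Finset.univ : Finset (Fin n)).powersetCard j,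
          (List.ofFn fun k => ι R (if k ∈ T' then y' k else x' k)).prod))) := by
    intro j _
    rw [smul_comm (q (j + (n - B.card))), ← mul_smul_comm]
  rw [Finset.sum_congr rfl hterm, ← Finset.smul_sum, ← Finset.mul_sum,
    sum_etaQ_truncate x' y' (fun j => q (j + (n - B.card))),
    sum_smul_etaQ_eq_sum_powerset x' y' (fun j => q (j + (n - B.card))), Finset.mul_sum]
  congr 1
  refine Finset.sum_congr rfl fun B' _ => ?_
  rw [mul_smul_comm, Nat.add_comm B'.card (n - B.card)]

end Summit.Ventures.HSemireg.Mod4Site
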